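import Mathlib
import Summits.ValiantsHypothesis.ValiantsHypothesis.Theses.GrenetZeon
import Summits.ValiantsHypothesis.ValiantsHypothesis.Theorems.GrenetZeonTwoDimCoefficientsDefs
import Literature.Computability.AlgebraicComplexity.MignonRessayreBound
import Literature.Computability.AlgebraicComplexity.StandardFamiliesProofs

/-!
# Crux `GrenetZeon.TwoDimCoefficients` (stmt-ValiantsHypothesis-8062), line `dim2_cases` —
# registered stub `stub_splitCase`: the SPLIT shape `per_n = α det A + β det B` gives `n² ≤ 8m`

**Claim settled** (TRUE given its two hypotheses, which the registered signature takes by name):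
`HessianRankCodimTwo → UnitDichotomy → ∃ C n₀, ∀ n ≥ n₀, ∀ m, SplitRepr n m → n² ≤ C·m`, with
`C = 8` and `n₀ = max(n₀(HessianRankCodimTwo), 3)`.

* `HessianRankCodimTwo` is the dependency crux stmt-ValiantsHypothesis-8061 of the route (for large
  `n`, every polynomial with a common zero with `per_n` has one, `p`, with
  `n² < 2·rank Hess per_n(p)`); `UnitDichotomy` is the line's stub 2 (no zero of the affine
  determinant `det A` on `Z(per_n)` ⇒ `det A` constant or `n² ≤ 2m + 2`).  Both are HYPOTHESES of
  this theorem, exactly as registered; nothing is claimed about them here.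
* Proof (`stub_splitCase`).  COMMON ZERO of `per_n` and `det A`: at the point `p` of
  `HessianRankCodimTwo`, `Hess per_n(p) = α Hess det A(p) + β Hess det B(p)` and `det B(p) = 0` unless
  `β = 0`, so each summand has rank `≤ 2m` by the tree's `rank_hess0_det_le` after translation
  (`rank_hess0_transl_det_le`; Mignon–Ressayre 2004 §2, Landsberg 2017 Exercise 6.4.5.2): `n² < 8m`.
  NO COMMON ZERO: `UnitDichotomy` for `A` gives `n² ≤ 2m + 2 ≤ 8m` (`n ≥ 3`) or `det A = c`; then
  `per_n = αc + β det B` and `det B` is tested the same way — a common zero gives `n² < 4m`, none gives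
  `n² ≤ 2m + 2` or `det B = c'`, and in the last case `per_n` would be constant (`perPoly_ne_C`,
  `deg per_n = n`).

HONEST FRAMING: a conditional constant-factor bound (`n² ≤ 8m`) inside the Mignon–Ressayre regime,
serving an ASIDE item; it does not bear on `VP ≠ VNP`.

References: T. Mignon, N. Ressayre, *A quadratic bound for the determinant and permanent problem*,
Int. Math. Res. Not. 2004:79, Thm. 1.1, §2; J. M. Landsberg, *Geometry and Complexity Theory*, CUP
2017, §6.4.5–6.4.6.
-/

-- single-conjunct layout `Summits/ValiantsHypothesis/ValiantsHypothesis`: the duplicated namespace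
-- component is mandated by the tree.
set_option linter.dupNamespace false

noncomputable section

namespace Summit.ValiantsHypothesis.ValiantsHypothesis.Cruxes.TwoDimCoefficients.DimTwoCases

open MvPolynomial Matrix
open Literature.Computability.AlgebraicComplexity
open Summit.ValiantsHypothesis.ValiantsHypothesis.Theses.GrenetZeon

namespace SplitCase

/-- The generic permanent is not a constant (`n ≥ 1`). [folklore] -/
theorem perPoly_ne_C {n : ℕ} (hn : 1 ≤ n) (c : ℂ) : perPoly (Fin n) ℂ ≠ C c := by
  intro h
  have hdeg : (perPoly (Fin n) ℂ).totalDegree = n := by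
    rw [(totalDegree_perPoly_holds (n := Fin n) (k := ℂ) : (perPoly (Fin n) ℂ).totalDegree = _),
      Fintype.card_fin]
  rw [h, totalDegree_C] at hdeg
  omega

/-- At a zero `p` of an affine determinant `det A`, the Hessian of `det A` at `p` (the Hessian at the
origin of the translate) has rank `≤ 2m` — the tree's `rank_hess0_det_le` after translation.
[cite: MignonRessayre2004, §2] -/
theorem rank_hess0_transl_det_le {n m : ℕ} (A : AffMat n m) (hA : IsAffine A)
    (p : Fin n × Fin n → ℂ) (hp : eval p A.det = 0) :
    (hess0 (transl p A.det)).rank ≤ 2 * m := by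
  rw [AlgHom.map_det]
  refine rank_hess0_det_le _ (fun i j => ?_) ?_
  · rw [AlgHom.mapMatrix_apply, Matrix.map_apply]
    exact (totalDegree_transl_le p (A i j)).trans (hA i j)
  · rw [← AlgHom.map_det, constantCoeff_transl, hp]

/-- Scaling does not raise the rank (restated from the tree for readability). [folklore] -/
theorem rank_smul_hess0_le {n : ℕ} (c : ℂ) (f : MvPolynomial (Fin n × Fin n) ℂ) (b : ℕ)
    (h : c ≠ 0 → (hess0 f).rank ≤ b) : (c • hess0 f).rank ≤ b := by
  by_cases hc : c = 0
  · rw [hc, zero_smul, Matrix.rank_zero]; exact Nat.zero_le _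
  · exact (rank_smul_le c _).trans (h hc)

/-- Two-summand rank subadditivity (from the tree's `rank_sum_le`). [folklore] -/
theorem rank_add_le {μ ν : Type*} [Fintype μ] [Fintype ν] (M N : Matrix μ ν ℂ) :
    (M + N).rank ≤ M.rank + N.rank := by
  have h := rank_sum_le (Finset.univ : Finset (Fin 2)) ![M, N]
  rw [Fin.sum_univ_two, Fin.sum_univ_two] at h
  simpa using h

/-- **Common-zero case of the SPLIT shape.** If `per_n = α det A + β det B` with `A`, `B` affine and
`p` is a common zero of `per_n` and `det A`, then the Hessian of `per_n` at `p` has rank `≤ 4m`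
(`det B(p) = 0` too unless `β = 0`; each determinant contributes `≤ 2m`).
[cite: MignonRessayre2004, §2] -/
theorem rank_hess0_transl_perPoly_le_of_split {n m : ℕ} {α β : ℂ} {A B : AffMat n m}
    (hA : IsAffine A) (hB : IsAffine B)
    (hper : perPoly (Fin n) ℂ = C α * A.det + C β * B.det)
    (p : Fin n × Fin n → ℂ) (hp : eval p (perPoly (Fin n) ℂ) = 0) (hpA : eval p A.det = 0) :
    (hess0 (transl p (perPoly (Fin n) ℂ))).rank ≤ 4 * m := by
  have hsplit : hess0 (transl p (perPoly (Fin n) ℂ)) =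
      α • hess0 (transl p A.det) + β • hess0 (transl p B.det) := by
    conv_lhs => rw [hper]
    rw [map_add, map_mul, map_mul, transl_C, transl_C, map_add, hess0_C_mul, hess0_C_mul]
  rw [hsplit]
  refine (rank_add_le _ _).trans ?_
  have h1 : (α • hess0 (transl p A.det)).rank ≤ 2 * m :=
    rank_smul_hess0_le α _ _ fun _ => rank_hess0_transl_det_le A hA p hpA
  have h2 : (β • hess0 (transl p B.det)).rank ≤ 2 * m := by
    refine rank_smul_hess0_le β _ _ fun hβ => rank_hess0_transl_det_le B hB p ?_
    have h := congrArg (eval p) hper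
    rw [map_add, map_mul, map_mul, eval_C, eval_C, hp, hpA, mul_zero, zero_add] at h
    exact (mul_eq_zero.mp h.symm).resolve_left hβ
  omega

end SplitCase

open SplitCase in
/-- **Registered stub `stub_splitCase`** (line `dim2_cases`, crux `TwoDimCoefficients`,
stmt-ValiantsHypothesis-8062): in the SPLIT shape `per_n = α det A + β det B` (`A`, `B` affine
`m × m`), the codimension-two Hessian point (`HessianRankCodimTwo`, the dependency crux stmt-8061,
taken as a hypothesis) and the unit dichotomy give `n² ≤ 8m` for `n ≥ max(n₀(8061), 3)`.
Proof.  If `per_n` and `det A` have a common zero, `HessianRankCodimTwo` supplies one, `p`, with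
`n² < 2·rank Hess per_n(p)`, and `rank Hess per_n(p) ≤ 2m + 2m` there
(`rank_hess0_transl_perPoly_le_of_split`): `n² < 8m`.  Otherwise `UnitDichotomy` for `A` gives
`n² ≤ 2m + 2 ≤ 8m` or `det A = c` (`c ≠ 0` since `per_n(0) = 0`); then `det B` is tested the same
way: a common zero of `per_n` and `det B` gives `n² < 2·(0 + 2m)`, no common zero gives
`n² ≤ 2m + 2` or `det B = c'`, and the last case makes `per_n` constant — absurd. [folklore] -/
theorem stub_splitCase : HessianRankCodimTwo → UnitDichotomy →
    ∃ C n₀ : ℕ, ∀ n ≥ n₀, ∀ m : ℕ, SplitRepr n m → n ^ 2 ≤ C * m := by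
  rintro ⟨nH, hH⟩ hU
  refine ⟨8, max nH 3, fun n hn m hS => ?_⟩
  have hnH : nH ≤ n := (le_max_left _ _).trans hn
  have hn3 : 3 ≤ n := (le_max_right _ _).trans hn
  have hn1 : 1 ≤ n := by omega
  have h9 : 9 ≤ n ^ 2 := by
    calc (9 : ℕ) = 3 ^ 2 := by norm_num
      _ ≤ n ^ 2 := Nat.pow_le_pow_left hn3 2
  obtain ⟨α, β, A, B, hA, hB, hper⟩ := hS
  -- Case 1: a common zero of `per_n` and `det A`.
  by_cases hZ : ∃ p : Fin n × Fin n → ℂ, eval p (perPoly (Fin n) ℂ) = 0 ∧ eval p A.det = 0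
  · obtain ⟨p, hp, hpA, hrank⟩ := hH n hnH A.det hZ
    have hle := rank_hess0_transl_perPoly_le_of_split hA hB hper p hp hpA
    omega
  -- Case 2: no common zero: unit dichotomy for `A`.
  push Not at hZ
  rcases hU n hn3 m A hA hZ with ⟨c, hc⟩ | hle
  swap
  · omega
  -- `det A = c`: now `per_n = αc + β det B`; test `det B` on the permanental hypersurface
  obtain ⟨γ, hper'⟩ : ∃ γ : ℂ, perPoly (Fin n) ℂ = C γ + C β * B.det :=
    ⟨α * c, by rw [hper, hc, ← map_mul]⟩
  by_cases hZB : ∃ p : Fin n × Fin n → ℂ, eval p (perPoly (Fin n) ℂ) = 0 ∧ eval p B.det = 0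
  · obtain ⟨p, hp, hpB, hrank⟩ := hH n hnH B.det hZB
    have hsplit : hess0 (transl p (perPoly (Fin n) ℂ)) = β • hess0 (transl p B.det) := by
      conv_lhs => rw [hper']
      rw [map_add, transl_C, map_mul, transl_C, map_add, hess0_C_mul,
        hess0_eq_zero_of_totalDegree_le_one (by rw [totalDegree_C]; exact Nat.zero_le _), zero_add]
    have hle : (hess0 (transl p (perPoly (Fin n) ℂ))).rank ≤ 2 * m := by
      rw [hsplit]
      exact rank_smul_hess0_le β _ _ fun _ => rank_hess0_transl_det_le B hB p hpB
    omega
  · push Not at hZB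
    rcases hU n hn3 m B hB hZB with ⟨c', hc'⟩ | hle
    · exfalso
      refine perPoly_ne_C hn1 (γ + β * c') ?_
      rw [hper', hc', ← map_mul, ← map_add]
    · omega

end Summit.ValiantsHypothesis.ValiantsHypothesis.Cruxes.TwoDimCoefficients.DimTwoCases

end
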